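import Mathlib
import Summits.ValiantsHypothesis.ValiantsHypothesis.Theorems.GrenetZeonHessianRankCodimTwoLatinTable
import HarnessLib

/-!
# The Latin block plane, `r = 0`: the TABLE IDENTITY (fibre count), II — the block table

Continuation of `…LatinTable.lean` (Theorem P part B, crux `GrenetZeon.HessianRankCodimTwo`,
stmt-ValiantsHypothesis-8061, line `good_plane`).  For the block value `h_{IJ}` of the Latin block
point (two rows `I·p, I·p+1` of block `I` and two columns `J·p, J·p+1` of block `J` removed):

* `blockPoly p hp I J = ((p−2)!·p!·p!) • blockTable p hp I J` (`blockPoly_eq_smul_blockTable`), where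
  `blockTable p hp I J = Σ_u Π_r X_{u r − rowBlock r}` runs over the colourings `u` of the REMAINING
  rows `{r // r ≠ I·p ∧ r ≠ I·p+1}` with multiplicities `|u⁻¹ K| = p − 2[K = J]`
  (steps: invert the permutation and pin, `blockPoly_eq_sum_filter`; move the pinned permutations to
  the permutations of the remaining rows by a fixed `θ` with `θ(I·p+s) = J·p+s`,
  `sum_filter_pinned_eq_sum_perm_subtype`; apply the engine `sum_perm_comp_eq_smul_sum`; count the
  labels `rowBlock (θ r)`, `card_subtype_rowBlock_perm_eq`);
* `blockTable` is homogeneous of degree `3p − 2`; generating-function side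
  `Π_{r remaining} f(rowBlock r) = Π_K f K ^ (p − 2[K = I])` (so its generating function is
  `ℓ_I^{p−2} Π_{I'≠I} ℓ_{I'}^p`); over `ℂ`: `h_{IJ}(latinPoint p 0 a) = (p−2)!·p!·p! · η̃_{IJ}(a)`, so a
  block value vanishes on the plane iff `aeval a (blockTable p hp I J) = 0`.

Nothing here moves VP ≠ VNP (bookkeeping inside the family `n = 3p` of the constant-factor crux).
-/

noncomputable section

open MvPolynomial Finset Equiv
open Literature.Computability.AlgebraicComplexity

-- single-conjunct layout `Summits/ValiantsHypothesis/ValiantsHypothesis`: duplicated namespace by design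
set_option linter.dupNamespace false

namespace Summit.ValiantsHypothesis.ValiantsHypothesis.Theorems.GrenetZeonHessianRankCodimTwo

section Latin

variable {p : ℕ}

/-! ### The block table -/

/-- The two chosen rows (columns) of one block are distinct. [folklore] -/
theorem blockIdx_zero_ne_blockIdx_one (hp : 2 ≤ p) (I J : Fin 3) :
    blockIdx p 0 hp I 0 ≠ blockIdx p 0 hp J 1 := by
  intro h
  have h' := congrArg Fin.val h
  simp only [blockIdx, Fin.val_zero, Fin.val_one, add_zero] at h'
  fin_cases I <;> fin_cases J <;> simp at h' <;> omega

/-- Step 1 for the block table: `blockPoly` as a sum over the permutations `τ` (rows → columns)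
pinned at the two removed positions, the weight being a product over the remaining rows.
[folklore] -/
theorem blockPoly_eq_sum_filter (hp : 2 ≤ p) (I J : Fin 3) :
    blockPoly p hp I J =
      ∑ τ ∈ univ.filter (fun τ : Perm (Fin (3 * p + 0)) =>
          τ (blockIdx p 0 hp I 0) = blockIdx p 0 hp J 0 ∧
            τ (blockIdx p 0 hp I 1) = blockIdx p 0 hp J 1),
        ∏ r ∈ univ.filter (fun r : Fin (3 * p + 0) =>
            r ≠ blockIdx p 0 hp I 0 ∧ r ≠ blockIdx p 0 hp I 1),
          (X (rowBlock p (τ r) - rowBlock p r) : MvPolynomial (Fin 3) ℤ) := by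
  have hj : blockIdx p 0 hp J 0 ≠ blockIdx p 0 hp J 1 := blockIdx_zero_ne_blockIdx_one hp J J
  unfold blockPoly
  rw [← Equiv.sum_comp (Equiv.inv (Perm (Fin (3 * p + 0))))]
  simp only [Equiv.inv_apply]
  rw [← Finset.sum_filter]
  refine Finset.sum_congr ?_ fun τ hτ => ?_
  · ext τ
    simp only [Finset.mem_filter, Finset.mem_univ, true_and, Perm.inv_eq_iff_eq]
    constructor
    · rintro ⟨h1, -, h0⟩
      exact ⟨h0.symm, h1.symm⟩
    · rintro ⟨h0, h1⟩
      exact ⟨h1.symm, hj, h0.symm⟩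
  · obtain ⟨h0, h1⟩ := (Finset.mem_filter.mp hτ).2
    symm
    refine Finset.prod_equiv τ (fun r => ?_) (fun r _ => ?_)
    · simp only [Finset.mem_filter, Finset.mem_univ, true_and, Finset.mem_erase, ne_eq, ← h0, ← h1,
        EmbeddingLike.apply_eq_iff_eq]
      tauto
    · simp only [dIdx_eq_sub, Perm.coe_inv, Equiv.symm_apply_apply]

/-- Step 2 for the block table: the pinned permutations `τ` correspond (via `τ ↦ θ⁻¹ τ` for any
fixed `θ` moving the removed rows onto the removed columns) to the permutations of the remaining
rows. [folklore] -/
theorem sum_filter_pinned_eq_sum_perm_subtype (hp : 2 ≤ p) (I J : Fin 3)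
    (θ : Perm (Fin (3 * p + 0)))
    (hθ₀ : θ (blockIdx p 0 hp I 0) = blockIdx p 0 hp J 0)
    (hθ₁ : θ (blockIdx p 0 hp I 1) = blockIdx p 0 hp J 1) :
    ∑ τ ∈ univ.filter (fun τ : Perm (Fin (3 * p + 0)) =>
          τ (blockIdx p 0 hp I 0) = blockIdx p 0 hp J 0 ∧
            τ (blockIdx p 0 hp I 1) = blockIdx p 0 hp J 1),
        ∏ r ∈ univ.filter (fun r : Fin (3 * p + 0) =>
            r ≠ blockIdx p 0 hp I 0 ∧ r ≠ blockIdx p 0 hp I 1),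
          (X (rowBlock p (τ r) - rowBlock p r) : MvPolynomial (Fin 3) ℤ) =
      ∑ ψ : Perm {r : Fin (3 * p + 0) // r ≠ blockIdx p 0 hp I 0 ∧ r ≠ blockIdx p 0 hp I 1},
        ∏ r, (X (rowBlock p (θ (ψ r).1) - rowBlock p r.1) : MvPolynomial (Fin 3) ℤ) := by
  set i₀ := blockIdx p 0 hp I 0 with hi₀
  set i₁ := blockIdx p 0 hp I 1 with hi₁
  set j₀ := blockIdx p 0 hp J 0 with hj₀
  set j₁ := blockIdx p 0 hp J 1 with hj₁
  -- the pinned permutations, corrected by `θ⁻¹`, preserve the set of remaining rows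
  have pres : ∀ τ ∈ univ.filter (fun τ : Perm (Fin (3 * p + 0)) => τ i₀ = j₀ ∧ τ i₁ = j₁),
      ∀ x, (fun r : Fin (3 * p + 0) => r ≠ i₀ ∧ r ≠ i₁) ((θ⁻¹ * τ) x) ↔
        (fun r : Fin (3 * p + 0) => r ≠ i₀ ∧ r ≠ i₁) x := by
    intro τ hτ x
    obtain ⟨h0, h1⟩ := (Finset.mem_filter.mp hτ).2
    have e0 : (θ⁻¹ * τ) x = i₀ ↔ x = i₀ := by
      rw [Perm.mul_apply, Perm.inv_eq_iff_eq, hθ₀, ← h0, EmbeddingLike.apply_eq_iff_eq]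
    have e1 : (θ⁻¹ * τ) x = i₁ ↔ x = i₁ := by
      rw [Perm.mul_apply, Perm.inv_eq_iff_eq, hθ₁, ← h1, EmbeddingLike.apply_eq_iff_eq]
    simp only [ne_eq, e0, e1]
  have fix : ∀ τ ∈ univ.filter (fun τ : Perm (Fin (3 * p + 0)) => τ i₀ = j₀ ∧ τ i₁ = j₁),
      ∀ x, (θ⁻¹ * τ) x ≠ x → (fun r : Fin (3 * p + 0) => r ≠ i₀ ∧ r ≠ i₁) x := by
    intro τ hτ x hx
    obtain ⟨h0, h1⟩ := (Finset.mem_filter.mp hτ).2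
    refine ⟨fun hx0 => hx ?_, fun hx1 => hx ?_⟩
    · rw [hx0, Perm.mul_apply, h0, ← hθ₀]
      simp
    · rw [hx1, Perm.mul_apply, h1, ← hθ₁]
      simp
  have hni₀ : ¬ (i₀ ≠ i₀ ∧ i₀ ≠ i₁) := fun h => h.1 rfl
  have hni₁ : ¬ (i₁ ≠ i₀ ∧ i₁ ≠ i₁) := fun h => h.2 rfl
  refine Finset.sum_bij' (fun τ hτ => (θ⁻¹ * τ).subtypePerm (pres τ hτ))
    (fun ψ _ => θ * Perm.ofSubtype ψ) (fun _ _ => Finset.mem_univ _) (fun ψ _ => ?_)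
    (fun τ hτ => ?_) (fun ψ _ => ?_) (fun τ hτ => ?_)
  · refine Finset.mem_filter.mpr ⟨Finset.mem_univ _, ?_, ?_⟩
    · rw [Perm.mul_apply, Perm.ofSubtype_apply_of_not_mem ψ hni₀, hθ₀]
    · rw [Perm.mul_apply, Perm.ofSubtype_apply_of_not_mem ψ hni₁, hθ₁]
  · rw [Perm.ofSubtype_subtypePerm (pres τ hτ) (fix τ hτ), mul_inv_cancel_left]
  · refine Equiv.ext fun x => Subtype.ext ?_
    simp only [Perm.subtypePerm_apply, Perm.mul_apply, Perm.ofSubtype_apply_coe, Perm.coe_inv,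
      Equiv.symm_apply_apply]
  · rw [Finset.prod_subtype (p := fun r : Fin (3 * p + 0) => r ≠ i₀ ∧ r ≠ i₁)
      (univ.filter fun r : Fin (3 * p + 0) => r ≠ i₀ ∧ r ≠ i₁) (fun x => by simp)]
    refine Fintype.prod_congr _ _ fun r => ?_
    simp only [Perm.subtypePerm_apply, Perm.mul_apply, Perm.coe_inv, Equiv.apply_symm_apply]

/-- Step 3 for the block table: the labelling `r ↦ rowBlock (θ r)` of the remaining rows has
`p − 2` labels `J` and `p` labels `K ≠ J`. [folklore] -/
theorem card_subtype_rowBlock_perm_eq (hp : 2 ≤ p) (I J : Fin 3) (θ : Perm (Fin (3 * p + 0)))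
    (hθ₀ : θ (blockIdx p 0 hp I 0) = blockIdx p 0 hp J 0)
    (hθ₁ : θ (blockIdx p 0 hp I 1) = blockIdx p 0 hp J 1) (K : Fin 3) :
    Fintype.card {r : {r : Fin (3 * p + 0) // r ≠ blockIdx p 0 hp I 0 ∧ r ≠ blockIdx p 0 hp I 1} //
        rowBlock p (θ r.1) = K} = if K = J then p - 2 else p := by
  set i₀ := blockIdx p 0 hp I 0 with hi₀
  set i₁ := blockIdx p 0 hp I 1 with hi₁
  set j₀ := blockIdx p 0 hp J 0 with hj₀
  set j₁ := blockIdx p 0 hp J 1 with hj₁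
  have hj : j₀ ≠ j₁ := blockIdx_zero_ne_blockIdx_one hp J J
  have hrj₀ : rowBlock p j₀ = J := rowBlock_blockIdx hp J 0
  have hrj₁ : rowBlock p j₁ = J := rowBlock_blockIdx hp J 1
  have e : {r : {r : Fin (3 * p + 0) // r ≠ i₀ ∧ r ≠ i₁} // rowBlock p (θ r.1) = K} ≃
      {c : Fin (3 * p + 0) // (c ≠ j₀ ∧ c ≠ j₁) ∧ rowBlock p c = K} :=
    (Equiv.subtypeSubtypeEquivSubtypeInter (fun r : Fin (3 * p + 0) => r ≠ i₀ ∧ r ≠ i₁)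
      (fun r => rowBlock p (θ r) = K)).trans
      (Equiv.subtypeEquiv θ fun r => by
        rw [← hθ₀, ← hθ₁]
        simp only [ne_eq, EmbeddingLike.apply_eq_iff_eq])
  rw [Fintype.card_congr e, Fintype.card_subtype]
  have hF : (univ.filter fun c : Fin (3 * p + 0) => (c ≠ j₀ ∧ c ≠ j₁) ∧ rowBlock p c = K) =
      ((univ.filter fun c : Fin (3 * p + 0) => rowBlock p c = K).erase j₀).erase j₁ := by
    ext c
    simp only [Finset.mem_filter, Finset.mem_univ, true_and, Finset.mem_erase, ne_eq]
    tauto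
  rw [hF]
  have hp0 : 0 < p := by omega
  by_cases hK : K = J
  · subst hK
    rw [if_pos rfl, Finset.card_erase_of_mem, Finset.card_erase_of_mem, card_filter_rowBlock_eq hp0]
    · omega
    · exact Finset.mem_filter.mpr ⟨Finset.mem_univ _, hrj₀⟩
    · exact Finset.mem_erase.mpr ⟨hj.symm, Finset.mem_filter.mpr ⟨Finset.mem_univ _, hrj₁⟩⟩
  · rw [if_neg hK, Finset.erase_eq_of_notMem, Finset.erase_eq_of_notMem, card_filter_rowBlock_eq hp0]
    · simp only [Finset.mem_filter, Finset.mem_univ, true_and, hrj₀]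
      exact fun h => hK h.symm
    · simp only [Finset.mem_erase, Finset.mem_filter, Finset.mem_univ, true_and, hrj₁, ne_eq]
      exact fun h => hK h.2.symm

/-- **Table identity for the block values:** `blockPoly p hp I J = ((p−2)!·p!·p!) • blockTable p hp I J`.
[folklore] -/
theorem blockPoly_eq_smul_blockTable (hp : 2 ≤ p) (I J : Fin 3) :
    blockPoly p hp I J =
      ((p - 2).factorial * p.factorial * p.factorial) • blockTable p hp I J := by
  have hii : blockIdx p 0 hp I 0 ≠ blockIdx p 0 hp I 1 := blockIdx_zero_ne_blockIdx_one hp I I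
  have hij : blockIdx p 0 hp I 0 ≠ blockIdx p 0 hp J 1 := blockIdx_zero_ne_blockIdx_one hp I J
  have hji : blockIdx p 0 hp J 0 ≠ blockIdx p 0 hp I 1 := blockIdx_zero_ne_blockIdx_one hp J I
  have hjj : blockIdx p 0 hp J 0 ≠ blockIdx p 0 hp J 1 := blockIdx_zero_ne_blockIdx_one hp J J
  -- a permutation moving the removed rows onto the removed columns
  obtain ⟨θ, hθ₀, hθ₁⟩ : ∃ θ : Perm (Fin (3 * p + 0)),
      θ (blockIdx p 0 hp I 0) = blockIdx p 0 hp J 0 ∧ θ (blockIdx p 0 hp I 1) = blockIdx p 0 hp J 1 := by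
    refine ⟨Equiv.swap (blockIdx p 0 hp I 0) (blockIdx p 0 hp J 0) *
      Equiv.swap (blockIdx p 0 hp I 1) (blockIdx p 0 hp J 1), ?_, ?_⟩
    · rw [Perm.mul_apply, Equiv.swap_apply_of_ne_of_ne hii hij, Equiv.swap_apply_left]
    · rw [Perm.mul_apply, Equiv.swap_apply_left, Equiv.swap_apply_of_ne_of_ne hij.symm hjj.symm]
  rw [blockPoly_eq_sum_filter, sum_filter_pinned_eq_sum_perm_subtype hp I J θ hθ₀ hθ₁]
  rw [show (∑ ψ : Perm {r : Fin (3 * p + 0) // r ≠ blockIdx p 0 hp I 0 ∧ r ≠ blockIdx p 0 hp I 1},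
        ∏ r, (X (rowBlock p (θ (ψ r).1) - rowBlock p r.1) : MvPolynomial (Fin 3) ℤ)) =
      ∑ ψ : Perm {r : Fin (3 * p + 0) // r ≠ blockIdx p 0 hp I 0 ∧ r ≠ blockIdx p 0 hp I 1},
        (fun u : {r : Fin (3 * p + 0) // r ≠ blockIdx p 0 hp I 0 ∧ r ≠ blockIdx p 0 hp I 1} → Fin 3 =>
          ∏ r, (X (u r - rowBlock p r.1) : MvPolynomial (Fin 3) ℤ))
          ((fun r : {r : Fin (3 * p + 0) // r ≠ blockIdx p 0 hp I 0 ∧ r ≠ blockIdx p 0 hp I 1} =>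
            rowBlock p (θ r.1)) ∘ ψ) from rfl]
  rw [sum_perm_comp_eq_smul_sum
    (fun r : {r : Fin (3 * p + 0) // r ≠ blockIdx p 0 hp I 0 ∧ r ≠ blockIdx p 0 hp I 1} =>
      rowBlock p (θ r.1))
    (fun u : {r : Fin (3 * p + 0) // r ≠ blockIdx p 0 hp I 0 ∧ r ≠ blockIdx p 0 hp I 1} → Fin 3 =>
      ∏ r, (X (u r - rowBlock p r.1) : MvPolynomial (Fin 3) ℤ))]
  have hN : ∏ K : Fin 3, (Fintype.card
      {r : {r : Fin (3 * p + 0) // r ≠ blockIdx p 0 hp I 0 ∧ r ≠ blockIdx p 0 hp I 1} //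
        rowBlock p (θ r.1) = K}).factorial = (p - 2).factorial * p.factorial * p.factorial := by
    simp_rw [card_subtype_rowBlock_perm_eq hp I J θ hθ₀ hθ₁]
    rw [← Finset.mul_prod_erase univ _ (Finset.mem_univ J), if_pos rfl,
      Finset.prod_congr rfl fun K hK =>
        (show (if K = J then p - 2 else p).factorial = p.factorial by
          rw [if_neg (Finset.ne_of_mem_erase hK)]),
      Finset.prod_const, Finset.card_erase_of_mem (Finset.mem_univ J), card_univ, Fintype.card_fin]
    ring
  unfold blockTable
  rw [hN]
  congr 1
  refine Finset.sum_congr (Finset.filter_congr fun u _ => ?_) fun _ _ => rfl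
  simp_rw [card_subtype_rowBlock_perm_eq hp I J θ hθ₀ hθ₁]

/-! ### Generating-function side and homogeneity -/

/-- The number of remaining rows of block `K` after removing the two chosen rows of block `I`
(filter form). [folklore] -/
theorem card_filter_subtype_rowBlock_eq (hp : 2 ≤ p) (I K : Fin 3) :
    #(univ.filter fun r : {r : Fin (3 * p + 0) // r ≠ blockIdx p 0 hp I 0 ∧ r ≠ blockIdx p 0 hp I 1} =>
        rowBlock p r.1 = K) = if K = I then p - 2 else p := by
  rw [← Fintype.card_subtype]
  exact card_subtype_rowBlock_perm_eq hp I I 1 rfl rfl K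

/-- `Π_{r ≠ i₀, i₁} f(rowBlock r) = Π_K f(K)^{p − 2[K = I]}`; with `f = ℓ` this says that the
generating function of `blockTable p hp I J` is `ℓ_I^{p−2} Π_{I'≠I} ℓ_{I'}^p`. [folklore] -/
theorem prod_subtype_comp_rowBlock_eq {M : Type*} [CommMonoid M] (hp : 2 ≤ p) (I : Fin 3)
    (f : Fin 3 → M) :
    ∏ r : {r : Fin (3 * p + 0) // r ≠ blockIdx p 0 hp I 0 ∧ r ≠ blockIdx p 0 hp I 1},
        f (rowBlock p r.1) = ∏ K, f K ^ (if K = I then p - 2 else p) := by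
  rw [← Finset.prod_fiberwise' univ
    (fun r : {r : Fin (3 * p + 0) // r ≠ blockIdx p 0 hp I 0 ∧ r ≠ blockIdx p 0 hp I 1} =>
      rowBlock p r.1) f]
  refine Fintype.prod_congr _ _ fun K => ?_
  rw [Finset.prod_const, card_filter_subtype_rowBlock_eq hp]

/-- The number of remaining rows after removing the two chosen rows of block `I` is `3p − 2`.
[folklore] -/
theorem card_subtype_ne_blockIdx (hp : 2 ≤ p) (I : Fin 3) :
    Fintype.card {r : Fin (3 * p + 0) // r ≠ blockIdx p 0 hp I 0 ∧ r ≠ blockIdx p 0 hp I 1} =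
      3 * p + 0 - 2 := by
  have hii : blockIdx p 0 hp I 0 ≠ blockIdx p 0 hp I 1 := blockIdx_zero_ne_blockIdx_one hp I I
  rw [Fintype.card_subtype]
  have hF : (univ.filter fun r : Fin (3 * p + 0) => r ≠ blockIdx p 0 hp I 0 ∧ r ≠ blockIdx p 0 hp I 1) =
      (univ.erase (blockIdx p 0 hp I 0)).erase (blockIdx p 0 hp I 1) := by
    ext r
    simp only [Finset.mem_filter, Finset.mem_univ, true_and, Finset.mem_erase, ne_eq]
    tauto
  rw [hF, Finset.card_erase_of_mem (Finset.mem_erase.mpr ⟨hii.symm, Finset.mem_univ _⟩),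
    Finset.card_erase_of_mem (Finset.mem_univ _), card_univ, Fintype.card_fin]
  omega

/-- `blockTable p hp I J` is homogeneous of degree `3p − 2`. [folklore] -/
theorem blockTable_isHomogeneous (hp : 2 ≤ p) (I J : Fin 3) :
    (blockTable p hp I J).IsHomogeneous (3 * p + 0 - 2) := by
  unfold blockTable
  refine IsHomogeneous.sum _ _ _ fun u _ => ?_
  have h := IsHomogeneous.prod Finset.univ
    (fun r : {r : Fin (3 * p + 0) // r ≠ blockIdx p 0 hp I 0 ∧ r ≠ blockIdx p 0 hp I 1} =>
      (X (u r - rowBlock p r.1) : MvPolynomial (Fin 3) ℤ)) (fun _ => 1) fun r _ => isHomogeneous_X _ _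
  simpa only [Finset.sum_const, card_univ, card_subtype_ne_blockIdx hp I, smul_eq_mul, mul_one] using h

/-! ### Consequences over `ℂ`: the Latin point -/

/-- The block value `h_{IJ}` of the Latin block point (`r = 0`) is `(p−2)!·p!·p! · η̃_{IJ}(a)`.
[folklore] -/
theorem latinBlockValue_zero_eq_mul_blockTable (hp : 2 ≤ p) (a : Fin 3 → ℂ) (I J : Fin 3) :
    latinBlockValue p 0 hp a I J =
      (((p - 2).factorial * p.factorial * p.factorial : ℕ) : ℂ) * aeval a (blockTable p hp I J) := by
  rw [latinBlockValue_zero_eq, blockPoly_eq_smul_blockTable hp, map_nsmul, nsmul_eq_mul]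

/-- On the Latin block plane (`r = 0`) the block value `h_{IJ}` vanishes iff the normalised table
`η̃_{IJ}` does. [folklore] -/
theorem latinBlockValue_zero_eq_zero_iff (hp : 2 ≤ p) (a : Fin 3 → ℂ) (I J : Fin 3) :
    latinBlockValue p 0 hp a I J = 0 ↔ aeval a (blockTable p hp I J) = 0 := by
  rw [latinBlockValue_zero_eq_mul_blockTable hp, mul_eq_zero, or_iff_right]
  exact_mod_cast mul_ne_zero (mul_ne_zero (Nat.factorial_ne_zero _) (Nat.factorial_ne_zero _))
    (Nat.factorial_ne_zero _)

end Latin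

end Summit.ValiantsHypothesis.ValiantsHypothesis.Theorems.GrenetZeonHessianRankCodimTwo
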